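import Summits.RiemannHypothesis.RiemannHypothesis.Theorems.Splittings.JensenMixedSplitRows
import Summits.RiemannHypothesis.RiemannHypothesis.Theorems.Splittings.JensenX4LaguerreHeredity
import Summits.RiemannHypothesis.RiemannHypothesis.Theorems.Splittings.JensenDerivativeLaguerre
import Literature.Analysis.Complex.FourierPolyaKiKimGenusZero
import Mathlib.Analysis.Calculus.IteratedDeriv.Lemmas
import Mathlib.Analysis.Real.Pi.Bounds
import Mathlib.Analysis.SpecialFunctions.Trigonometric.Bounds
import HarnessLib

/-!
# Splittings / Jensen — the DEGENERATE-CRITICAL-POINT witness `G_{c,K}` — FILE 1/4: DEFINITIONS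

Carve (cell rh-split, seat rh-split-jen-neg gen 9, RULING #94 (c)) of the refereed stage file
`HOME/rh-split-jen-neg/g8/stage/JensenDegenerateCritical.lean` (sha16 6de8f964827225eb, 985 l; scratch of record
`HOME/rh-split-jen-neg/g8/SketchG8.lean`, card `cards/SPLIT-jen-neg.md` ADDENDUM 9) into four files sharing this
namespace: `…Defs` (this file: the seven definitions `q₁ q₂ G c₀ K₀ σ Ptoy`), `…Core` (§1–§5 ODE / derivative /
values / reality / growth), `…Signs` (§6–§8 Taylor positivity, certified signs, critical points; §14 polynomial toy),
`JensenDegenerateCritical` (§9–§13 the packaged witness and the refuted schemata).  Every declaration block is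
byte-identical to the stage file; only docstrings were added to previously undocumented declarations.

ORIGINAL HEADER OF THE STAGE FILE (mathematical content, labels):

# Splittings / Jensen — the DEGENERATE-CRITICAL-POINT witness `G_{c,K}`: the strict Laguerre sign in the
# `X-4` / `T18` splitting is load-bearing (class level)

Cell rh-split, seat rh-split-jen-neg (gen 8; card `cards/SPLIT-jen-neg.md` ADDENDUM 9), scratch of record
`HOME/rh-split-jen-neg/g8/SketchG8.lean` (namespace `RhSplitJenNegG8`; this staged copy differs only in the
namespace line and this header paragraph).

Question answered (card `SPLIT-jen-neg.md`, ADD.8 item G7-4): in the `X-4` splitting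
`RH ⟺ RowsFromOne ∧ RowZeroLaguerre` (tree: `rh_iff_rowsFromOne_and_rowZeroLaguerre`; function level
`rh_iff_xiPrimeOnLine_and_laguerreAtCriticalPoints`, `T18`) the `B`/`C′` conjunct carries a STRICT sign
`Ξ(x)·Ξ''(x) < 0` at real critical points off the zeros.  Is strictness load-bearing, i.e. does the
NON-STRICT (`≤ 0`) form — which tolerates a degenerate critical point `Ξ' = Ξ'' = 0 ≠ Ξ` — still combine
with `A` (zeros of `Ξ'` real / rows `n ≥ 1` hyperbolic) to give reality of zeros?  **No, at class level**:

* `G(w) = K + 4 w · C'(w) · q₁(w) - 2 C(w) · q₂(w)`, `C = cosh √·` (`coshSqrt`),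
  `q₁ = w² + (2c+20) w + (c²+12c+120)`, `q₂ = 5w² + (6c+60) w + (c²+12c+120)`, is built so that
  `G'(w) = (w + c)² · cosh √w` EXACTLY (`deriv_G`; design = the ODE `4w C'' + 2C' = C`, `coshSqrt_ode`).
* Parameters `c₀ = 1/1000`, `K₀ = 1203/5 = 240.6` (`c₀`, `K₀`).  Certified in the kernel:
  `G(0) = 0.575998 > 0` (`re_G_zero_pos`), `G(-c₀) ≥ 0.456 > 0` (`re_G_neg_c₀_pos`, via `sin t ≤ t`,
  `cos t ≤ 1`), `G(s_j) < 0` for even `j` / `> 0` for odd `j` at the sea points `s_j = -((2j+1)π/2)²`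
  (`re_G_sea_neg_of_even` — `j = 0` needs `π` to six digits, `Real.pi_gt_d6` / `Real.pi_lt_d6` —,
  `re_G_sea_pos_of_odd`), `G(s_j)·G''(s_j) < 0` (`laguerre_sea`), all Taylor coefficients real `> 0`
  (`taylor_pos`, Leibniz), growth `‖G(w)‖ ≤ A·exp(‖w‖^{3/4})` (`exists_norm_G_le`).
* Consequences (all sorry-free): `G` real entire of order `< 1` (`isEntireOfOrderLt_one_G`,
  `isEntireOfOrderLtOne_G`); every zero of `G'` — indeed of every `G^{(l+1)}` — is real
  (`zeros_deriv_G_real`, `zeros_real_iteratedDeriv_succ`: the `X1`/`A`-analogue); the real critical points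
  are exactly `-c₀` and the `s_j` (`deriv_G_ofReal_eq_zero_iff`); the real trace satisfies the HEREDITARY
  NON-STRICT Laguerre inequalities at all levels (`hereditary_laguerre_le`; STRICT at levels `≥ 1`,
  `laguerre_strict_level_succ`, and at the sea points), with the single equality case at the DEGENERATE
  critical point `-c₀`: `g'(-c₀) = g''(-c₀) = 0 < g(-c₀)` (`degenerate_point`,
  `not_hasNoFourierCriticalPoint_trace`); every Jensen row `n ≥ 1` is hyperbolic (`splits_jensenPoly_G`,
  the `RowsFromOne`-analogue; `eventuallyHyperbolic_G`); `G` has infinitely many real zeros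
  (`infinite_real_zeros`, IVT between consecutive sea points) — AND a non-real zero (`exists_nonreal_zero`:
  if all zeros were real, the tree's strict Laguerre lemma `laguerre_sign` would force
  `G(-c₀)·G''(-c₀) < 0`, but `G''(-c₀) = 0`); hence `¬ AllHyperbolic` (`not_allHyperbolic_G`).
* Packaged: `degenerateShadowWitness`; the refuted schemata `not_nonStrictLaguerre_implies_realZeros`
  (Ki–Kim 2000 Thm 4.1 = tree `KiKim.im_eq_zero_of_noCrit_of_order_lt_one` with `<` weakened to `≤`, even
  adding «zeros of `F'` real») and `not_rowsFromOne_and_nonStrictLaguerre_implies_allHyperbolic` (the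
  `X-4` shadow with non-strict `B`); contrast `strictLaguerre_implies_realZeros` (the tree's theorem).
* Reading for the `X-4` card: the strict sign in `B`/`C′` is load-bearing; its content beyond the
  non-strict inequality is «`Ξ_F` has no degenerate critical point off its zeros» (RH-implied — under RH,
  `Ξ_F ∈ 𝓛𝓟` and Laguerre is strict off the zeros —, no finite falsifier, simplicity-type).  Numerics
  (`degen_check2.py`, pure python): one non-real pair `0.640789 ± 0.898827 i`; real zeros
  `-1.531, -3.097, -29.42, -78.53, …`.

* §14, the polynomial toy (same mechanism outside the Ξ-like class, kernel): `P = X⁴/4 + 5X³/3 + 7X²/2 + 3X + 1`,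
  `P' = (X+1)²(X+3)` hyperbolic, non-strict Laguerre at both critical points (`-1` degenerate, `-3` strict),
  `P(-1) = 1/12`, yet `¬ P.Splits` (`not_splits_Ptoy`, via the tree's `laguerre_strict_of_splits`); hence the
  `X-4` glue `JointPoly.splits_of_derivative_splits_of_laguerre` is false with `<` weakened to `≤`
  (`not_splits_of_derivative_splits_of_laguerre_le`).  The transcendental `G` is what carries the
  mechanism INTO the class (positive Taylor data at all orders, infinitely many real zeros, order `1/2`).
* In print (anchoring, not novelty): the qualitative phenomenon «a degenerate (even-multiplicity) critical
  point off the zeros costs a couple of non-real zeros» is the case `m` even, `k = m/2` of Pólya's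
  critical-point count, proved for genus `0` by Ki–Kim (Duke Math. J. 104 (2000), (1.1) and Theorem A:
  «a real integral function of genus 0 has just as many critical points as couples of imaginary zeros»);
  `G_{c₀,K₀}` has exactly one critical point in that sense (`-c₀`, `l = 1`, `m = 2`), matching the one
  non-real pair found numerically.  New here is only the explicit closed-form witness inside the Ξ-like
  class (positive Taylor data, rows `n ≥ 1` hyperbolic, infinitely many real zeros), kernel-checked, and
  its use on the `X-4`/`T18` splitting.  The strict Laguerre inequality in `𝓛𝓟` with equality only at
  multiple zeros is classical (Csordas–Escassut, Ann. Math. Blaise Pascal 12 (2005), Thm 2.1).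

HONEST LABEL: «SPLITTING SEARCH over kernel-typed RH-EQUIVALENCES; a splitting A ∧ B ⟹ RH is CONDITIONAL
bookkeeping unless A and B are both proved; nothing here bears on the truth of RH.»
-/

set_option linter.dupNamespace false
set_option linter.style.longLine false

noncomputable section

namespace Summit.RiemannHypothesis.RiemannHypothesis.Theorems.Splittings.JensenDegenerateCritical

open Complex
open scoped Real ComplexConjugate Nat
open Literature.Barriers.RiemannHypothesis
open Literature.NumberTheory.LFunctions (jensenPoly exists_sq_eq iteratedDeriv_conj_of_conj)
open Literature.Analysis.TotalPositivity (IsEntireOfOrderLtOne)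
open Literature.Analysis.Complex (IsEntireOfOrderLt HasNoFourierCriticalPoint)
open Summit.RiemannHypothesis.RiemannHypothesis.Theorems.Splittings.JensenMixedSplit

/-! ## Definitions (§2 `q₁ q₂ G`, §7 `c₀ K₀`, §11 `σ`, §14 `Ptoy`) -/

/-- `q₁(w) = w² + (2c+20) w + (c²+12c+120)`. -/
def q₁ (c : ℝ) (w : ℂ) : ℂ := w ^ 2 + (2 * c + 20) * w + (c ^ 2 + 12 * c + 120)

/-- `q₂(w) = 5w² + (6c+60) w + (c²+12c+120)`. -/
def q₂ (c : ℝ) (w : ℂ) : ℂ := 5 * w ^ 2 + (6 * c + 60) * w + (c ^ 2 + 12 * c + 120)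

/-- `G_{c,K}(w) = K + 4 w C'(w) q₁(w) - 2 C(w) q₂(w)`. -/
def G (c K : ℝ) (w : ℂ) : ℂ :=
  (K : ℂ) + 4 * w * deriv coshSqrt w * q₁ c w - 2 * coshSqrt w * q₂ c w

/-- `c₀ = 1/1000`. -/
def c₀ : ℝ := 1 / 1000

/-- `K₀ = 240.6`. -/
def K₀ : ℝ := 1203 / 5

/-- The sea abscissa `σ_j = -((2j+1)π/2)²`. -/
def σ (j : ℕ) : ℝ := -(((2 * j + 1) * Real.pi / 2) ^ 2)

section toy

open Polynomial

/-- `P = X⁴/4 + 5X³/3 + 7X²/2 + 3X + 1`. -/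
def Ptoy : ℝ[X] := C (1 / 4) * X ^ 4 + C (5 / 3) * X ^ 3 + C (7 / 2) * X ^ 2 + C 3 * X + C 1

end toy

end Summit.RiemannHypothesis.RiemannHypothesis.Theorems.Splittings.JensenDegenerateCritical
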